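import Summits.AtomisticToContinuum.FouriersLaw.Theorems.BondHeatUncertaintySubdiffusiveBondHeatGibbsPositionEighthMoment

/-!
# `N`-uniform one-site bounds under the configurational Gibbs weight, at EVERY site

Support file for item `stmt-AtomisticToContinuum-9139` (`OddSectorIrreversibility.OddCorrectorDecay`), negative
side, towards the bath-locality estimate: the static Gibbs input "every one-site marginal of the pinned chain is
dominated by the one-site Gibbs state, uniformly in the length and in the site". Extends the transfer-recursion /
Wintner / Chebyshev machinery of `…SubdiffusiveBondHeatGibbsPositionEighthMomentMarginal` (sites `0` and `1`)
to all sites `k`, by carrying a radially non-increasing LEFT factor `L(q₀)` through the recursion: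
* `lintegral_coord_zero_leftFactor_le` — Chebyshev step at site `0` for the weight `L(q₀) e^{-Φ_N(q)/T}`;
* `lintegral_coord_leftFactor_le` — the same at every site `k` (induction on `k`, peeling the first coordinate:
  the new left factor `L'(b) = ∫ L(a) e^{-U(a)/T} e^{-V(b-a)/T} da` is again radially non-increasing);
* `lintegral_coord_potential_le` — `L = 1`: for every measurable radially non-decreasing `h : ℝ → ℝ≥0∞`,
  `(∫ h(q_k) e^{-Φ_N/T} dq)(∫ e^{-U/T}) ≤ (∫ h e^{-U/T})(∫ e^{-Φ_N/T} dq)`, all `N`, all `k`;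
* `pinnedChain_lintegral_coord_gibbsWeight_le` — the phase-space form for the pinned chain's weight
  `e^{-H/T} dq dp` (momenta factor out): `E_N[h(q_k)] ≤ ∫ h e^{-U/T} / ∫ e^{-U/T}` uniformly in `N, k`.
Hypotheses as in the source file: `U, V` continuous and radially non-decreasing, `T ≥ 0`.
-/

noncomputable section

open MeasureTheory Set
open scoped ENNReal

namespace Summit.AtomisticToContinuum.FouriersLaw.Theorems.ChainVariation

open Literature.MathematicalPhysics.KineticTheory.HeatConduction
open Summit.AtomisticToContinuum.FouriersLaw.Theorems.SubdiffusiveBondHeat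

section Transfer

variable {P : OscillatorChain} (hUc : Continuous P.U) (hVc : Continuous P.V)
  (hU : ∀ ⦃a b : ℝ⦄, |a| ≤ |b| → P.U a ≤ P.U b) (hV : ∀ ⦃a b : ℝ⦄, |a| ≤ |b| → P.V a ≤ P.V b)
  {T : ℝ} (hT : 0 ≤ T)
include hUc hVc hU hV hT

/-- **Chebyshev step at site `0` with a left factor.** For `N = m+1 ≥ 1`, a measurable radially
non-increasing `L` and a measurable radially non-decreasing `h`:
`(∫ h(q₀) L(q₀) e^{-Φ_N/T} dq)(∫ e^{-U/T}) ≤ (∫ h e^{-U/T})(∫ L(q₀) e^{-Φ_N/T} dq)`. [folklore] -/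
theorem lintegral_coord_zero_leftFactor_le (m : ℕ) {L : ℝ → ℝ≥0∞} (hLm : Measurable L)
    (hLa : ∀ ⦃a b : ℝ⦄, |a| ≤ |b| → L b ≤ L a) {h : ℝ → ℝ≥0∞} (hh : Measurable h)
    (hhm : ∀ ⦃a b : ℝ⦄, |a| ≤ |b| → h a ≤ h b) :
    (∫⁻ q : Fin (m + 1) → ℝ, h (q 0) * (L (q 0) *
        ENNReal.ofReal (Real.exp (-P.potential (m + 1) q / T)))) *
        ∫⁻ a, ENNReal.ofReal (Real.exp (-P.U a / T)) ≤
      (∫⁻ a, h a * ENNReal.ofReal (Real.exp (-P.U a / T))) *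
        ∫⁻ q : Fin (m + 1) → ℝ, L (q 0) * ENNReal.ofReal (Real.exp (-P.potential (m + 1) q / T)) := by
  obtain ⟨G, hGm, hGa, hG⟩ := exists_marginal_factor hUc hVc hU hV hT m
  have hUm : Measurable P.U := hUc.measurable
  have hΦ : Measurable (P.potential (m + 1)) := (continuous_potential P hUc hVc _).measurable
  have red : ∀ {F : ℝ → ℝ≥0∞}, Measurable F →
      ∫⁻ q : Fin (m + 1) → ℝ, F (q 0) * ENNReal.ofReal (Real.exp (-P.potential (m + 1) q / T)) =
        ∫⁻ a, F a * G a * ENNReal.ofReal (Real.exp (-P.U a / T)) := by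
    intro F hF
    rw [lintegral_fin_succ_eq_cons m (show Measurable (fun q : Fin (m + 1) → ℝ =>
      F (q 0) * ENNReal.ofReal (Real.exp (-P.potential (m + 1) q / T))) by fun_prop)]
    refine lintegral_congr fun a => ?_
    simp only [Fin.cons_zero]
    rw [lintegral_const_mul'' _ (show Measurable (fun q : Fin m → ℝ =>
      ENNReal.ofReal (Real.exp (-P.potential (m + 1) (Fin.cons a q) / T))) by
        fun_prop).aemeasurable, hG a]
    ring
  have e1 : ∫⁻ q : Fin (m + 1) → ℝ, h (q 0) * (L (q 0) * ENNReal.ofReal (Real.exp (-P.potential (m + 1) q / T))) =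
      ∫⁻ q : Fin (m + 1) → ℝ, (fun b => h b * L b) (q 0) * ENNReal.ofReal (Real.exp (-P.potential (m + 1) q / T)) :=
    lintegral_congr fun q => by simp only; ring
  rw [e1, red (F := fun b => h b * L b) (by fun_prop), red hLm]
  have hch := chebyshev_lintegral (w := fun a => ENNReal.ofReal (Real.exp (-P.U a / T))) (h := h)
    (g := fun a => L a * G a) (by fun_prop) hh (hLm.mul hGm) hhm (radAnti_mul hLa hGa)
  have e2 : ∫⁻ a, h a * L a * G a * ENNReal.ofReal (Real.exp (-P.U a / T)) =
      ∫⁻ a, h a * (L a * G a) * ENNReal.ofReal (Real.exp (-P.U a / T)) :=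
    lintegral_congr fun a => by ring
  rw [e2]
  exact hch

/-- **Chebyshev step at every site, with a left factor.** For `N = m+1`, every site `k`, every measurable
radially non-increasing `L` and measurable radially non-decreasing `h`:
`(∫ h(q_k) L(q₀) e^{-Φ_N/T} dq)(∫ e^{-U/T}) ≤ (∫ h e^{-U/T})(∫ L(q₀) e^{-Φ_N/T} dq)`.
Induction on `m`, peeling the first coordinate: the weight seen by the remaining chain carries the new left
factor `L'(b) = ∫ L(a) e^{-U(a)/T} e^{-V(b-a)/T} da`, radially non-increasing by Wintner's lemma.
[folklore] -/
theorem lintegral_coord_leftFactor_le :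
    ∀ (m : ℕ) (k : Fin (m + 1)) {L : ℝ → ℝ≥0∞}, Measurable L → (∀ ⦃a b : ℝ⦄, |a| ≤ |b| → L b ≤ L a) →
      ∀ {h : ℝ → ℝ≥0∞}, Measurable h → (∀ ⦃a b : ℝ⦄, |a| ≤ |b| → h a ≤ h b) →
    (∫⁻ q : Fin (m + 1) → ℝ, h (q k) * (L (q 0) *
        ENNReal.ofReal (Real.exp (-P.potential (m + 1) q / T)))) *
        ∫⁻ a, ENNReal.ofReal (Real.exp (-P.U a / T)) ≤
      (∫⁻ a, h a * ENNReal.ofReal (Real.exp (-P.U a / T))) *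
        ∫⁻ q : Fin (m + 1) → ℝ, L (q 0) * ENNReal.ofReal (Real.exp (-P.potential (m + 1) q / T)) := by
  intro m
  induction m with
  | zero =>
    intro k L hLm hLa h hh hhm
    have hk : k = 0 := Fin.eq_zero k
    subst hk
    exact lintegral_coord_zero_leftFactor_le hUc hVc hU hV hT 0 hLm hLa hh hhm
  | succ m ih =>
    intro k L hLm hLa h hh hhm
    refine Fin.cases ?_ (fun k' => ?_) k
    · exact lintegral_coord_zero_leftFactor_le hUc hVc hU hV hT (m + 1) hLm hLa hh hhm
    · -- peel the first coordinate
      have hUm : Measurable P.U := hUc.measurable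
      have hVm : Measurable P.V := hVc.measurable
      have hΦ₁ : Measurable (P.potential (m + 1)) := (continuous_potential P hUc hVc _).measurable
      have hΦ₂ : Measurable (P.potential (m + 2)) := (continuous_potential P hUc hVc _).measurable
      have hea := radAnti_ofReal_exp_neg_div hU hT
      have hga := radAnti_ofReal_exp_neg_div hV hT
      set L' : ℝ → ℝ≥0∞ := fun b => ∫⁻ a, (L a * ENNReal.ofReal (Real.exp (-P.U a / T))) *
        ENNReal.ofReal (Real.exp (-P.V (b - a) / T)) with hL'
      have hL'm : Measurable L' := Measurable.lintegral_prod_right (by fun_prop)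
      have hL'a : ∀ ⦃a b : ℝ⦄, |a| ≤ |b| → L' b ≤ L' a :=
        radAnti_lintegral_mul_sub (by fun_prop) (by fun_prop) (radAnti_mul hLa hea) hga
      -- the peeling identity, for any measurable `F` in place of `h`
      have peel : ∀ {F : ℝ → ℝ≥0∞}, Measurable F →
          ∫⁻ q : Fin (m + 2) → ℝ, F (q k'.succ) * (L (q 0) *
            ENNReal.ofReal (Real.exp (-P.potential (m + 2) q / T))) =
          ∫⁻ q : Fin (m + 1) → ℝ, F (q k') * (L' (q 0) *
            ENNReal.ofReal (Real.exp (-P.potential (m + 1) q / T))) := by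
        intro F hF
        calc ∫⁻ q : Fin (m + 2) → ℝ, F (q k'.succ) * (L (q 0) *
              ENNReal.ofReal (Real.exp (-P.potential (m + 2) q / T)))
            = ∫⁻ a, ∫⁻ q : Fin (m + 1) → ℝ, F (q k') * ((L a * ENNReal.ofReal (Real.exp (-P.U a / T))) *
                ENNReal.ofReal (Real.exp (-P.V (q 0 - a) / T))) *
                  ENNReal.ofReal (Real.exp (-P.potential (m + 1) q / T)) := by
              rw [lintegral_fin_succ_eq_cons (m + 1) (show Measurable (fun q : Fin (m + 2) → ℝ =>
                F (q k'.succ) * (L (q 0) * ENNReal.ofReal (Real.exp (-P.potential (m + 2) q / T)))) by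
                  fun_prop)]
              refine lintegral_congr fun a => lintegral_congr fun q => ?_
              simp only [Fin.cons_succ, Fin.cons_zero]
              rw [ofReal_exp_neg_potential_cons_succ]
              ring
          _ = ∫⁻ q : Fin (m + 1) → ℝ, ∫⁻ a, F (q k') * ((L a * ENNReal.ofReal (Real.exp (-P.U a / T))) *
                ENNReal.ofReal (Real.exp (-P.V (q 0 - a) / T))) *
                  ENNReal.ofReal (Real.exp (-P.potential (m + 1) q / T)) :=
              lintegral_lintegral_swap (by fun_prop)
          _ = ∫⁻ q : Fin (m + 1) → ℝ, F (q k') * (L' (q 0) *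
                ENNReal.ofReal (Real.exp (-P.potential (m + 1) q / T))) := by
              refine lintegral_congr fun q => ?_
              have e : ∀ a, F (q k') * ((L a * ENNReal.ofReal (Real.exp (-P.U a / T))) *
                  ENNReal.ofReal (Real.exp (-P.V (q 0 - a) / T))) *
                    ENNReal.ofReal (Real.exp (-P.potential (m + 1) q / T)) =
                  (L a * ENNReal.ofReal (Real.exp (-P.U a / T))) *
                    ENNReal.ofReal (Real.exp (-P.V (q 0 - a) / T)) *
                    (F (q k') * ENNReal.ofReal (Real.exp (-P.potential (m + 1) q / T))) := fun a => by ring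
              simp_rw [e]
              rw [lintegral_mul_const _ (show Measurable (fun a : ℝ =>
                (L a * ENNReal.ofReal (Real.exp (-P.U a / T))) *
                  ENNReal.ofReal (Real.exp (-P.V (q 0 - a) / T))) by fun_prop)]
              simp only [hL']
              ring
      have hone := peel (F := fun _ => 1) measurable_const
      simp only [one_mul] at hone
      rw [peel hh, hone]
      exact ih k' hL'm hL'a hh hhm

/-- **One-site domination at every site** (`L = 1`): for every `N = m+1`, every site `k` and every
measurable radially non-decreasing `h : ℝ → ℝ≥0∞`,
`(∫ h(q_k) e^{-Φ_N(q)/T} dq)(∫ e^{-U/T}) ≤ (∫ h e^{-U/T})(∫ e^{-Φ_N(q)/T} dq)`, i.e.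
`E_N[h(q_k)] ≤ ∫ h e^{-U/T} / ∫ e^{-U/T}` uniformly in `N` and `k`. [folklore] -/
theorem lintegral_coord_potential_le (m : ℕ) (k : Fin (m + 1)) {h : ℝ → ℝ≥0∞} (hh : Measurable h)
    (hhm : ∀ ⦃a b : ℝ⦄, |a| ≤ |b| → h a ≤ h b) :
    (∫⁻ q : Fin (m + 1) → ℝ, h (q k) * ENNReal.ofReal (Real.exp (-P.potential (m + 1) q / T))) *
        ∫⁻ a, ENNReal.ofReal (Real.exp (-P.U a / T)) ≤
      (∫⁻ a, h a * ENNReal.ofReal (Real.exp (-P.U a / T))) *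
        ∫⁻ q : Fin (m + 1) → ℝ, ENNReal.ofReal (Real.exp (-P.potential (m + 1) q / T)) := by
  have h1 := lintegral_coord_leftFactor_le hUc hVc hU hV hT m k (L := fun _ => 1) measurable_const
    (fun _ _ _ => le_rfl) hh hhm
  simpa only [one_mul] using h1

end Transfer

/-! ### The pinned chain: phase-space form -/

section Pinned

variable {ω₂ lam β : ℝ} (hω : 0 < ω₂) (hl : 0 ≤ lam) (hβ : 0 ≤ β) (γ : ℝ) {T : ℝ} (hT : 0 < T)
include hω hl hβ hT

/-- **`N`-uniform one-site domination for the pinned chain's Gibbs weight `e^{-H/T} dq dp`, every site.**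
For every `N`, every site `k` and every measurable radially non-decreasing `h : ℝ → ℝ≥0∞`:
`(∫ h(q_k) e^{-H(x)/T} dx)(∫ e^{-U/T}) ≤ (∫ h e^{-U/T})(∫ e^{-H(x)/T} dx)` (the momenta factor out of
`H = ∑p²/2 + Φ`). [folklore] -/
theorem pinnedChain_lintegral_coord_gibbsWeight_le {N : ℕ} (k : Fin N) {h : ℝ → ℝ≥0∞}
    (hh : Measurable h) (hhm : ∀ ⦃a b : ℝ⦄, |a| ≤ |b| → h a ≤ h b) :
    (∫⁻ x : PhaseSpace N, h (x.1 k) *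
        ENNReal.ofReal (Real.exp (-(pinnedChain ω₂ lam β γ).hamiltonian N x / T))) *
        ∫⁻ a, ENNReal.ofReal (Real.exp (-(pinnedChain ω₂ lam β γ).U a / T)) ≤
      (∫⁻ a, h a * ENNReal.ofReal (Real.exp (-(pinnedChain ω₂ lam β γ).U a / T))) *
        ∫⁻ x : PhaseSpace N, ENNReal.ofReal (Real.exp (-(pinnedChain ω₂ lam β γ).hamiltonian N x / T)) := by
  set P := pinnedChain ω₂ lam β γ with hP
  obtain ⟨m, rfl⟩ : ∃ m, N = m + 1 := ⟨N - 1, by have := k.pos; omega⟩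
  have hUc : Continuous P.U := (pinnedChain_contDiff_U ω₂ lam β γ (n := 0)).continuous
  have hVc : Continuous P.V := (pinnedChain_contDiff_V ω₂ lam β γ (n := 0)).continuous
  have hΦ : Measurable (P.potential (m + 1)) := (continuous_potential P hUc hVc _).measurable
  have hUr := pinnedChain_U_radMono (β := β) hω.le hl γ
  have hVr := pinnedChain_V_radMono hβ ω₂ lam γ
  -- factorisation of the weight
  have hKc : Continuous fun p : Fin (m + 1) → ℝ => Real.exp (-(∑ j, p j ^ 2 / 2) / T) := by fun_prop
  set K : ℝ≥0∞ := ∫⁻ p : Fin (m + 1) → ℝ, ENNReal.ofReal (Real.exp (-(∑ j, p j ^ 2 / 2) / T)) with hK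
  have hρ : ∀ z : PhaseSpace (m + 1), Real.exp (-P.hamiltonian (m + 1) z / T) =
      Real.exp (-P.potential (m + 1) z.1 / T) * Real.exp (-(∑ j, z.2 j ^ 2 / 2) / T) := by
    intro z
    rw [P.hamiltonian_eq_kinetic_add_potential, ← Real.exp_add]
    congr 1
    ring
  have hI : ∫⁻ z : PhaseSpace (m + 1), h (z.1 k) * ENNReal.ofReal (Real.exp (-P.hamiltonian (m + 1) z / T)) =
      (∫⁻ q : Fin (m + 1) → ℝ, h (q k) * ENNReal.ofReal (Real.exp (-P.potential (m + 1) q / T))) * K := by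
    rw [hK, ← lintegral_prod_mul (by fun_prop) hKc.measurable.ennreal_ofReal.aemeasurable]
    refine lintegral_congr fun z => ?_
    rw [hρ, ENNReal.ofReal_mul (by positivity), mul_assoc]
  have hZ : ∫⁻ z : PhaseSpace (m + 1), ENNReal.ofReal (Real.exp (-P.hamiltonian (m + 1) z / T)) =
      (∫⁻ q : Fin (m + 1) → ℝ, ENNReal.ofReal (Real.exp (-P.potential (m + 1) q / T))) * K := by
    rw [hK, ← lintegral_prod_mul (by fun_prop) hKc.measurable.ennreal_ofReal.aemeasurable]
    refine lintegral_congr fun z => ?_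
    rw [hρ, ENNReal.ofReal_mul (by positivity)]
  have hq := lintegral_coord_potential_le hUc hVc hUr hVr hT.le m k hh hhm
  rw [hI, hZ, mul_right_comm, ← mul_assoc]
  exact mul_le_mul_left hq K

end Pinned

end Summit.AtomisticToContinuum.FouriersLaw.Theorems.ChainVariation

end
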